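import Summits.HodgeConjecture.HodgeConjecture.Theorems.PadicSemiregularLiftHodgeFermatVarietiesTwinAssembly
import Summits.HodgeConjecture.HodgeConjecture.Theorems.PadicSemiregularLiftHodgeFermatVarietiesSinglePayoff
import HarnessLib

/-!
# HC for EVERY Fermat fourfold of degree prime to `6`: every Hodge multiset of length `≤ 6` at a level prime to `6` is reachable — programme T6 of line `cancel-by-any-claim-lattice`, crux `HodgeFermatVarieties` (stmt-HodgeConjecture-1334)

Crux `HodgeFermatVarieties` (stmt-HodgeConjecture-1334), line `cancel-by-any-claim-lattice`, programme T6 (lead c4,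
skeleton generation 16: the SEXTUPLE TWIN CORE `35 ∣ m` removed). Everything here is PROVED (no `sorry`, no new
definition, no new named fact); the file assembles the landed pieces

* `PairedNull.stub_exists_fibre_of_not_paired_le_six` (`…TwinAssembly`, T6-L2: at a level `m` prime to `6`, a
  non-paired Hodge multiset `s` of length `≤ 6` contains, for `p₁ = 5` or `p₁ = 7` dividing `m`, all but one of the
  `p₁` points `A + j(m/p₁)` of a progression with `p₁A ≠ 0` — the level analysis with BOTH small primes allowed: the
  twin boundary brick `…FibreOfBoundaryTwin`, the level-`35` kill `…TwinThirtyFive`, `…FibreOfTopLevelTwin`,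
  `…ExistsFibreOfNotPairedTwin`),
* `CoprimeSix.stub_relReach_shorter` (`…RelReachShorter`, the strip step for any `p₁`),
* `CoprimeSix.exists_pairs_of_count_symm`, `CoprimeSix.reach_pairs` (`…CoprimeSixPayoff`, `…SinglePayoff`),

into:

* `stub_reach_le_six` (registered) and its named form `reach_le_six` — **EVERY HODGE MULTISET OF LENGTH `≤ 6` OF
  `ℤ/m`, `(m, 6) = 1`, IS ℤ-REACHABLE FROM THE PRINTED SUPPLY AT ITS OWN LEVEL** (strong induction on the length:
  symmetric multiplicities give pairs; otherwise T6-L2 and the strip step give a shorter Hodge `t`,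
  `#t = #s + 3 − p₁ < #s`, reachable relative to `s`);
* `hodgeConjectureFor_fourfold_coprime_six_all` — **THE HODGE CONJECTURE FOR EVERY SMOOTH PROJECTIVE COMPLEX FERMAT
  FOURFOLD `X⁴ₘ` OF DEGREE `m` PRIME TO `6`**, granted exactly the hypotheses of every earlier pay-off of the line: the
  printed facts S0 (Aoki 1987 Thm 1-4 (i),(ii), Thm 1-1, Thm 2-1; Aoki–Shioda 1983 (2.1)) and the statements of the
  stubs S2↑/S2↓ (claim along level raising), S3a (Shioda's semi-decomposable supply) and S5 (eigenspace structure,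
  Ran Prop. 1.7), spelled verbatim as in `…DoublingHodge` / `…SinglePayoff`: every Hodge character of `X⁴ₘ` has six
  entries, its value multiset is reachable at level `m`, hence claimed (`Doubling.claimMultiset_of_stableReach`), and
  the per-dimension transfer `hodgeConjectureFor_of_claims_dim` at `(m, 2)` applies. This is the statement of
  da Silva 2021 Thm. 3.3, whose printed proof only reaches the characters inside Shioda's condition `(P⁴ₘ)`; the new
  degrees beyond S16/GS²/`5q` are those divisible by `35`: `X⁴₁₇₅`, `X⁴₂₄₅`, `X⁴₃₈₅`, `X⁴₄₅₅`, `X⁴₅₉₅`, `X⁴₁₂₂₅`, ….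

So: HC for every Fermat fourfold of degree prime to `6`, modulo the printed facts S0 and the stub statements
S2/S3a/S5; the engine S4 is not used (no residual sign class of length `6` at any level prime to `6`). What is NOT
here: length `8` at levels divisible by `35` — the first GENUINE instance of the engine, `V(gap₃₅) ⊂ H⁶(X⁶₃₅)`
(`gap₃₅ = {1,2,16,17,21,22,30,31}` survives level raising to every tested multiple) — and the levels divisible by `2`
or `3`.

References: [Aoki1983] N. Aoki, Math. Ann. 266 (1983) 23–54, Thm. A′ (§7), Prop. 2.2, Prop. 6.4, Lemma 4.4, §9;
[Aoki1987] N. Aoki, J. Math. Soc. Japan 39 (1987) §1 p. 386–387, Thm. 1-1, Thm. 1-2 (p. 387), Thm. 1-4, Thm. 2-1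
(p. 388); [Shioda1979PJA] T. Shioda, Proc. Japan Acad. 55A (1979) §2 Thm. 1; [Ran1980] Z. Ran, Compositio Math. 42
(1980) Prop. 1.7; [daSilva2021HodgeFermat] G. da Silva Jr., arXiv:2101.04739, Thm. 3.3.
-/

-- every sibling file of the line declares into `…CancelByAnyClaimLattice.CoprimeSix` from a differently named module
set_option linter.dupNamespace false

noncomputable section

open Finset
open CategoryTheory AlgebraicGeometry
open Literature.AlgebraicGeometry Literature.AlgebraicGeometry.Motives Literature.AlgebraicTopology.SingularHomology
open Literature.AlgebraicGeometry.HodgeTheory Literature.AlgebraicGeometry.HodgeTheory.FermatCharacter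

namespace Summit.HodgeConjecture.HodgeConjecture.Theorems.CancelByAnyClaimLattice.CoprimeSix

/-- `Supply[M]` — the printed supply of level `M` (local notation of the line, verbatim). -/
local notation3 (prettyPrint := false) "Supply[" M "]" =>
  ({s : Multiset (ZMod M) | ∃ a : ZMod M, a ≠ 0 ∧ s = ({a, -a} : Multiset (ZMod M))} ∪
    {s : Multiset (ZMod M) | IsHodgeMultiset s ∧ Multiset.card s = 4} ∪
    {s : Multiset (ZMod M) | IsHodgeMultiset s ∧ IsSemiDecomposable s} ∪
    {s : Multiset (ZMod M) | ∃ (p : ℕ) (a : ZMod M), p.Prime ∧ p ≠ 2 ∧ p ∣ M ∧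
        2 < (M / p) / Nat.gcd (ZMod.val a) (M / p) ∧
        s = Multiset.map (fun j : ℕ => a + (j : ZMod M) * ((M / p : ℕ) : ZMod M)) (Multiset.range p) +
              {-((p : ZMod M) * a)}} : Set (Multiset (ZMod M)))

/-- `Reach[M, s]` (local notation of the line, verbatim). -/
local notation3 (prettyPrint := false) "Reach[" M ", " s "]" =>
  ∃ P N : Multiset (Multiset (ZMod M)),
    (∀ u ∈ P, u ∈ Supply[M]) ∧ (∀ u ∈ N, u ∈ Supply[M]) ∧ s + Multiset.sum N = Multiset.sum P

/-- `LevelRaise[k, m, s]` (local notation of the line, verbatim). -/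
local notation3 (prettyPrint := false) "LevelRaise[" k ", " m ", " s "]" =>
  Multiset.map (fun a : ZMod m => ((k * ZMod.val a : ℕ) : ZMod (k * m))) s

/-- `StableReach[m, s]` (local notation of the line, verbatim). -/
local notation3 (prettyPrint := false) "StableReach[" m ", " s "]" => ∃ k : ℕ, 0 < k ∧ Reach[k * m, LevelRaise[k, m, s]]

/-- The statement of stub S2↑ (pull-back of claim along level raising). Local notation only, verbatim
`…DoublingHodge`. -/
local notation3 (prettyPrint := false) "LevelClaimPull" =>
  ∀ (m k r : ℕ) (α' : Fin (2 * r + 2) → ZMod m), 0 < k → (∀ i, α' i ≠ 0) →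
    FermatCharacter.Claim m r α' → FermatCharacter.Claim (k * m) r (fun i => ((k * (α' i).val : ℕ) : ZMod (k * m)))

/-- The statement of stub S2↓ (push-forward of claim along level raising). Local notation only, verbatim
`…DoublingHodge`. -/
local notation3 (prettyPrint := false) "LevelClaimPush" =>
  ∀ (m k r : ℕ) (α' : Fin (2 * r + 2) → ZMod m), 0 < k → (∀ i, α' i ≠ 0) →
    FermatCharacter.Claim (k * m) r (fun i => ((k * (α' i).val : ℕ) : ZMod (k * m))) → FermatCharacter.Claim m r α'

/-- The statement of stub S3a (Shioda's semi-decomposable supply is claimed). Local notation only, verbatim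
`…DoublingHodge`. -/
local notation3 (prettyPrint := false) "SemiClaim" =>
  ∀ (M : ℕ) [NeZero M] (s : Multiset (ZMod M)), IsHodgeMultiset s → IsSemiDecomposable s → ClaimMultiset M s

/-- The statement of stub S5 (eigenspace structure of `H²ᵖ(X²ᵖₘ)`, Ran Prop. 1.7) at every level. Local
notation only, verbatim `…DoublingHodge`. -/
local notation3 (prettyPrint := false) "EigenStructure" =>
  ∀ (m : ℕ) [NeZero m] ⦃p : ℕ⦄, 0 < p →
    (∀ α : Fin (2 * p + 2) → ZMod m, α ≠ 0 → (∃ i, α i = 0) → fermatEigenspace m α (2 * p) = ⊥) ∧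
    (fermatEigenspace m (0 : Fin (2 * p + 2) → ZMod m) (2 * p) ≤
      LinearMap.range (complexBetti.map (SmoothHypersurface.hypersurfaceι (fermatPolynomial ℂ (2 * p) m)) (2 * p)).hom) ∧
    (∀ (A : HodgeModel (2 * p) (fermatHypersurface (2 * p) m)) (β : Fin (2 * p + 2) → ZMod m),
      (∀ i, β i ≠ 0) →
      (∃ x ∈ fermatEigenspace m β (2 * p), x ≠ 0 ∧ A.pullback (2 * p) x ∈ A.hodgePQ (2 * p) p p) →
        2 * FermatCharacter.normSum β = m * (2 * p + 2))

section Reach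

variable {m : ℕ} [NeZero m]

/-! ### §1 T6-main: every Hodge multiset of length `≤ 6` at a level prime to `6` is reachable -/

/-- **T6-main `stub_reach_le_six` — EVERY HODGE MULTISET OF LENGTH `≤ 6` AT A LEVEL PRIME TO `6` IS REACHABLE AT ITS
OWN LEVEL** (registered signature of line `cancel-by-any-claim-lattice`). Strong induction on `#s`: if every residue
occurs in `s` as often as its negative, `s` is a juxtaposition of pairs (`exists_pairs_of_count_symm`, `reach_pairs`);
otherwise T6-L2 (`PairedNull.stub_exists_fibre_of_not_paired_le_six`) gives `p₁ ∈ {5, 7}`, `p₁ ∣ m` and all but one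
of the `p₁` points `A + j(m/p₁)` inside `s` with `p₁A ≠ 0`, the strip step (`stub_relReach_shorter`) gives a Hodge
`t` with `#t + (p₁ - 1) = #s + 2` (so `#t < #s`) and `s + ΣN = t + ΣP`, the induction hypothesis gives
`t + ΣN' = ΣP'`, and `s + Σ(N + N') = Σ(P + P')`. [cite: Aoki1983, Thm. A′ (§7)]
[cite: Aoki1987, Thm. 1-2 (p. 387) and Thm. 2-1] -/
theorem stub_reach_le_six : ∀ (m : ℕ) [NeZero m], m.Coprime 6 → ∀ s : Multiset (ZMod m), IsHodgeMultiset s → Multiset.card s ≤ 6 → Reach[m, s] := by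
  intro m _ hm6 s hs h6
  -- adapted from `…SinglePayoff` (`stub_reach_single`), T6-L2 in place of GS-L2
  suffices h : ∀ (k : ℕ) (s : Multiset (ZMod m)), Multiset.card s = k → k ≤ 6 → IsHodgeMultiset s → Reach[m, s] from
    h _ s rfl h6 hs
  intro k
  induction k using Nat.strong_induction_on with
  | _ k ih =>
  intro s hk hk6 hs
  by_cases hsym : ∀ x : ZMod m, Multiset.count x s = Multiset.count (-x) s
  · obtain ⟨Q, hQ, rfl⟩ := exists_pairs_of_count_symm hm6 _ s rfl hs hsym
    exact reach_pairs Q hQ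
  · push Not at hsym
    obtain ⟨p₁, hp57, hp, A, hA, hfib⟩ :=
      PairedNull.stub_exists_fibre_of_not_paired_le_six m hm6 s hs (hk ▸ hk6) hsym
    have hp₁ : p₁.Prime := by
      rcases hp57 with rfl | rfl
      · exact Nat.prime_five
      · decide
    have hp₁5 : 5 ≤ p₁ := by rcases hp57 with rfl | rfl <;> norm_num
    obtain ⟨t, ht, hcard, P, N, hP, hN, hEq⟩ := stub_relReach_shorter p₁ hp₁ hp₁5 m hm6 hp s hs A hA hfib
    have hlt : Multiset.card t < k := by omega
    obtain ⟨P', N', hP', hN', hEq'⟩ := ih _ hlt t rfl (by omega) ht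
    refine ⟨P + P', N + N', ?_, ?_, ?_⟩
    · intro u hu
      rcases Multiset.mem_add.mp hu with h | h
      · exact hP u h
      · exact hP' u h
    · intro u hu
      rcases Multiset.mem_add.mp hu with h | h
      · exact hN u h
      · exact hN' u h
    · rw [Multiset.sum_add, Multiset.sum_add, ← add_assoc, hEq, add_assoc, add_comm P.sum, ← add_assoc, hEq']
      abel

/-- **T6-main, named hypotheses: every Hodge multiset of length `≤ 6` of `ℤ/m`, `(m, 6) = 1`, is reachable at its own
level** (`stub_reach_le_six`). [cite: Aoki1983, Thm. A′ (§7)] [cite: Aoki1987, Thm. 1-2 (p. 387) and Thm. 2-1] -/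
theorem reach_le_six (hm6 : m.Coprime 6) {s : Multiset (ZMod m)} (hs : IsHodgeMultiset s) (h6 : Multiset.card s ≤ 6) :
    Reach[m, s] :=
  stub_reach_le_six m hm6 s hs h6

end Reach

/-! ### §2 Pay-off: HC for every Fermat fourfold of degree prime to `6` -/

/-- **THE HODGE CONJECTURE FOR EVERY SMOOTH PROJECTIVE COMPLEX FERMAT FOURFOLD OF DEGREE PRIME TO `6`**, granted the
named facts Aoki 1987 Thm 1-4 (i) `hJ`, (ii) `hC`, Thm 1-1 `hP`, Thm 2-1 `hS`, Aoki–Shioda 1983 (2.1) `hNS`, and the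
statements of the stubs S2↑ `hPull`, S2↓ `hPush`, S3a `h3a`, S5 `h5` (exactly the hypotheses of every earlier pay-off
of the line): every Hodge character `α` of `X⁴ₘ` has `6` entries, so its value multiset is reachable at level `m`
(`reach_le_six`), hence claimed (`Doubling.claimMultiset_of_stableReach`), and the per-dimension transfer
`hodgeConjectureFor_of_claims_dim` at `(m, 2)` applies. New degrees (beyond S16, GS², `5q`): `X⁴₁₇₅`, `X⁴₂₄₅`, `X⁴₃₈₅`,
`X⁴₄₅₅`, `X⁴₅₉₅`, `X⁴₁₂₂₅`. [cite: daSilva2021HodgeFermat, Thm. 3.3] [cite: Aoki1983, Thm. A′ (§7)]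
[cite: Aoki1987, Thm. 1-2 (p. 387) and Thm. 2-1] -/
theorem hodgeConjectureFor_fourfold_coprime_six_all
    (hJ : Aoki1987_claim_juxtaposition) (hC : Aoki1987_claim_of_claim_juxtaposition_paired)
    (hP : Shioda_claim_paired) (hNS : AokiShioda1983_eigenline_le_neronSeveri) (hS : Aoki1987_claim_pStandard)
    (hPull : LevelClaimPull) (hPush : LevelClaimPush) (h3a : SemiClaim) (h5 : EigenStructure)
    {m : ℕ} [NeZero m] (hm6 : m.Coprime 6)
    ⦃X : SchemeOver ℂ⦄ (hF : IsFermatVariety 4 m X) (hX : IsSmoothProjective 4 X) : HodgeConjectureFor 4 X := by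
  refine hodgeConjectureFor_of_claims_dim (m := m) (p := 2) two_pos (h5 m two_pos).1 (h5 m two_pos).2.1
    (h5 m two_pos).2.2 (fun α hα ↦ ?_) hF hX
  have hs : IsHodgeMultiset (univ.val.map α) := hα.isHodgeMultiset
  have hcard : Multiset.card (univ.val.map α) = 6 := by rw [card_univ_val_map]
  have hs0 : univ.val.map α ≠ 0 := fun h0 ↦ by
    have h := congrArg Multiset.card h0
    rw [hcard, Multiset.card_zero] at h
    omega
  have hR : Reach[m, univ.val.map α] := reach_le_six hm6 hs hcard.le
  exact (claimMultiset_univ_val_map_iff α).1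
    (Doubling.claimMultiset_of_stableReach hJ hC hP hNS hS hPull hPush h3a hs0 hs
      (Doubling.stableReach_of_reach hR))

end Summit.HodgeConjecture.HodgeConjecture.Theorems.CancelByAnyClaimLattice.CoprimeSix

end
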